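import Literature.NumberTheory.LFunctions.WeilTwoPrimeCellsT120
import Literature.NumberTheory.LFunctions.WeilTwoPrimeMinorant
import Summits.RiemannHypothesis.RiemannHypothesis.Theorems.WeilTwoPrimeCellsT120NuPart43
import HarnessLib

/-!
# Two-prime minorant cells on `[0, 120]`: kernel facts for the partial moment sums, group 90 (`q = 520`)

`cellsMomentQ₂₃ wL chunk q = nuPart_t_q` by `decide +kernel`, one declaration per (chunk, q). Pure proof file (continuation of the Literature chain `WeilTwoPrimeCellsT120NuFact0..85`).
-/

noncomputable section

set_option linter.dupNamespace false

namespace Summit.RiemannHypothesis.RiemannHypothesis.Theorems.EvenWinsBeyondArch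

open Literature.NumberTheory.LFunctions

set_option maxHeartbeats 0 in
/-- The partial moment sum over chunk 0 at `q = 520`. [folklore] -/
theorem nuPartT120_0_520_eq :
    cellsMomentQ₂₃ weilTwoPrimeCellsT120Level weilTwoPrimeCellsT120C0 520 = nuPartT120_0_520 := by
  decide +kernel

set_option maxHeartbeats 0 in
/-- The partial moment sum over chunk 1 at `q = 520`. [folklore] -/
theorem nuPartT120_1_520_eq :
    cellsMomentQ₂₃ weilTwoPrimeCellsT120Level weilTwoPrimeCellsT120C1 520 = nuPartT120_1_520 := by
  decide +kernel

set_option maxHeartbeats 0 in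
/-- The partial moment sum over chunk 2 at `q = 520`. [folklore] -/
theorem nuPartT120_2_520_eq :
    cellsMomentQ₂₃ weilTwoPrimeCellsT120Level weilTwoPrimeCellsT120C2 520 = nuPartT120_2_520 := by
  decide +kernel

set_option maxHeartbeats 0 in
/-- The partial moment sum over chunk 3 at `q = 520`. [folklore] -/
theorem nuPartT120_3_520_eq :
    cellsMomentQ₂₃ weilTwoPrimeCellsT120Level weilTwoPrimeCellsT120C3 520 = nuPartT120_3_520 := by
  decide +kernel

set_option maxHeartbeats 0 in
/-- The partial moment sum over chunk 4 at `q = 520`. [folklore] -/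
theorem nuPartT120_4_520_eq :
    cellsMomentQ₂₃ weilTwoPrimeCellsT120Level weilTwoPrimeCellsT120C4 520 = nuPartT120_4_520 := by
  decide +kernel

set_option maxHeartbeats 0 in
/-- The partial moment sum over chunk 5 at `q = 520`. [folklore] -/
theorem nuPartT120_5_520_eq :
    cellsMomentQ₂₃ weilTwoPrimeCellsT120Level weilTwoPrimeCellsT120C5 520 = nuPartT120_5_520 := by
  decide +kernel


end Summit.RiemannHypothesis.RiemannHypothesis.Theorems.EvenWinsBeyondArch
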